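/-
Copyright (c) 2026 the pub-hodgecm-mathlib formalisation cell (harness21).  Prover seat hodgecm-mathlib-K2E4-p08 (g2), Track B «K2-LIT» ∕ h413, ‹S› ROAD J brick J1′ (the export):
the S1 DRESS WITH THE VALUE OF THE TRANSFER AT THE CENTRE `ε_H = (a·1₂, u)`.  2026-09-04.
-/
import Summits.HodgeConjecture.HodgeConjecture.Theorems.K2E3SingularDescentValueAtCentre           -- ★ J1 p855498 (this seat): descent at `ε` with the value `ψ_ε(ε_H) = Φ(ε, ψ; ν_G ∕ θ_*ν_H)`
import Literature.NumberTheory.Rogawski1990.LocalTransferCentralSingularS1DressCM                   -- ★ A-p16: the S1 dress (brings (SEP′), (side∕disj), (Δ-θ) dock payers)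
import Literature.NumberTheory.Rogawski1990.LocalTransferCentralSingularJunctionInvValueCM         -- ★ rung 1 p855792: junction with value
import Literature.NumberTheory.Rogawski1990.LocalTransferCompactSideJunctionValueCM                -- ★ rung 3 p855836: compact side with value over ★ J2♯ p855763
import Literature.NumberTheory.Rogawski1990.LocalTransferCentralSingularCompactPackageValueCM      -- ★ rung 5: compact package with values (ε′, descent value, named Δ‴ constant)
import HarnessLib

/-!
# J1′ — the S1 dress WITH THE VALUE OF THE TRANSFER AT THE CENTRE (road J of ‹S›, crux h413)

Cell `pub/hodgecm-mathlib`, Track B «K2-LIT», crux H413 = `stmt-HodgeConjecture-24833`; ‹S› = `sig_K2E3SingularTransferSigned` (E3-owned), ROAD J (K2E3-plan (g1) BATCH #3,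
2026-09-03T22:57:30Z): the SIGNED singular transfer is the VALUE AT `ε_H` of Track A's S1-dress transfer `φ^H = Δ₀·ψ_ε + ψ′` followed by (B_loc) and (J3).  THIS FILE is the
export J1′ asked for by the road-J assembler K2E4-p06 (g2) (23:14:12Z): ★ A-p16's S1 dress `exists_nhds_stableOrbitalIntegralRel_eq_of_central_singular_of_compactSide` ∘ ★ A-p14's
package `exists_compactSidePackage_of_badFrame`, REPLAYED WITH VALUES through this seat's rungs 1–5 (★ p855792, p855815, p855836, p855857, rung 5) and ★ J1 (p855498), with (R2)
discharged by the Euler–Poincaré letter WITH NEGATIVE CENTRAL VALUE ★ `rankOneEulerPoincareNonsplit_withCentralValue` (p855763, J2♯).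

THE STATEMENT.  The ∀-prefix of `stub_N6nsS1pkg` VERBATIM (`μ`, measurable families, Haar families `ν_H ν_G`, `μ` unitary with restriction `ω_{L∕L⁺}`, `H′` hermitian
anisotropic, `v` non-split, canonical `m_H m_G`, `φ ∈ C_c^∞(G′_v)`, `ε_H = (a·1₂, u)` with `u ≠ a`, the central dock `(ε, y, θ)`, the bad frame `(W, G₁, G₁′, G₂, G₂′, P′)`), ONE
more hypothesis — the orbit of `ε` is closed (`(ε − a)(ε − u) = 0`, ★ `isClosed_conjClass_local_of_mul_sub_smul_eq_zero`) —, and the conclusion: there are the framed SECOND CLASS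
`ε′` (`ε′·P′ = P′·(a·1₂ ⊕ᶠ u)`, matched with `ε_H`) and the Euler–Poincaré constant `r > 0` of `(pr₁)_*ν_H` such that `stub_N6nsS1`'s body holds (`∃ V ∈ 𝓝 ε_H, ∃ φ^H ∈ C_c^∞(H_v)`,
`Φ^st_H(γ_H, φ^H) = Σᶠ_c Δ‴_v(γ_H, c)·Φ(c, φ)` for `G`-regular `γ_H ∈ V`) AND
  **`φ^H(ε_H) = Δ‴_v(ε_H, ε) · Φ(ε, φ; ν_G ∕ θ_*ν_H) + Δ‴_v(ε_H, ε′) · (∫_{G′_v} φ(y ε′ y⁻¹) dν_G(y)) · (−r)`**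
— the ε-sheet with the quotient-measure orbital integral at the dock point, the ε′-sheet with the PLAIN Haar integral over `G′_v` (`Z(ε′)` is compact) weighted by the NEGATIVE
central value `−r` of Kottwitz's `f_EP`; and ★ `finExplicitDelta_eq_neg_of_not_isConj_of_fst_eq_smul_one` gives `Δ‴_v(ε_H, ε′) = −Δ‴_v(ε_H, ε)` (the Kottwitz sign flip between the
sheets, [Rogawski1990, §8.2 pp. 117–122]).  Next on road J (not here): (B_loc) ★ p855527 turns this value into `f^H(ε_H)` for EVERY local transfer `f^H` of `φ`, and (J3) identifies
`r` with the EP ∕ Steinberg formal-degree constant in the crux's measure currency.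

* **`exists_nhds_local_transfer_and_apply_centre`**.

HONEST LABEL: HC_CM is proved only modulo the 7 printed citations (2 remaining named inputs: hLiu418 = `stmt-HodgeConjecture-24832`, h413 = `stmt-HodgeConjecture-24833`) until
rung 0 closes; this file is a `--supports` helper (assembly over ★ files; one extra hypothesis `hεO`), it pays no socket by itself.
-/

set_option autoImplicit false
set_option linter.dupNamespace false

noncomputable section

open Set Filter Topology MeasureTheory MeasureTheory.Measure NumberField IsDedekindDomain Matrix
open Literature.NumberTheory.Automorphic Literature.NumberTheory.Automorphic.UnitaryGroup Literature.NumberTheory.GaloisRepresentations Literature.MeasureTheory.Group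
open Literature.NumberTheory.Rogawski1990
open Literature.AlgebraicGeometry.ShimuraVarieties (unitaryGroup)
open Summit.HodgeConjecture.HodgeConjecture.Cruxes.H413.K2E3SingularDescentValueAtCentre
open scoped MatrixGroups

namespace Summit.HodgeConjecture.HodgeConjecture.Cruxes.H413.K2E3SingularTransferDressValueAtCentre

open scoped Classical in
/-- **J1′ — THE S1 DRESS WITH THE VALUE OF THE TRANSFER AT THE CENTRE.**  See the module docstring: `stub_N6nsS1pkg`'s prefix, the closed orbit of the dock point `ε`, then
`∃ ε′ r`, the frame relation and matching of `ε′`, `0 < r`, `stub_N6nsS1`'s body, and `φ^H(ε_H) = Δ‴(ε_H,ε)·Φ(ε, φ; ν_G∕θ_*ν_H) + Δ‴(ε_H,ε′)·(∫ φ(yε′y⁻¹) dν_G)·(−r)`.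
[cite: Rogawski1990, §8.2 Prop. 8.2.1 (a)(d) pp. 112–122; §8.1 Prop. 8.1.3 pp. 110–111; §12.6 p. 174] [cite: LanglandsShelstad1990Descent, Thm. 2.3.A, §2.4] [cite: Kottwitz1988, §2 Theorem 2] -/
theorem exists_nhds_local_transfer_and_apply_centre :
    ∀ (L : Type) [Field L] [NumberField L] [IsCMField L] (H' : Matrix (Fin 3) (Fin 3) L) (μ : HeckeCharacter L)
      [∀ v : HeightOneSpectrum (𝓞 ↥(maximalRealSubfield L)),
        MeasurableSpace ((UnitaryGroup.cmDatum L 2 (Matrix.of fun i j : Fin 2 => if i.val + j.val + 1 = 2 then (1 : L) else 0)).Local v ×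
          (UnitaryGroup.cmDatum L 1 (Matrix.of fun i j : Fin 1 => if i.val + j.val + 1 = 1 then (1 : L) else 0)).Local v)]
      [∀ v : HeightOneSpectrum (𝓞 ↥(maximalRealSubfield L)),
        BorelSpace ((UnitaryGroup.cmDatum L 2 (Matrix.of fun i j : Fin 2 => if i.val + j.val + 1 = 2 then (1 : L) else 0)).Local v ×
          (UnitaryGroup.cmDatum L 1 (Matrix.of fun i j : Fin 1 => if i.val + j.val + 1 = 1 then (1 : L) else 0)).Local v)]
      [∀ v : HeightOneSpectrum (𝓞 ↥(maximalRealSubfield L)), MeasurableSpace ((UnitaryGroup.cmDatum L 3 H').Local v)]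
      [∀ v : HeightOneSpectrum (𝓞 ↥(maximalRealSubfield L)), BorelSpace ((UnitaryGroup.cmDatum L 3 H').Local v)]
      (νH : ∀ v : HeightOneSpectrum (𝓞 ↥(maximalRealSubfield L)),
        Measure ((UnitaryGroup.cmDatum L 2 (Matrix.of fun i j : Fin 2 => if i.val + j.val + 1 = 2 then (1 : L) else 0)).Local v ×
          (UnitaryGroup.cmDatum L 1 (Matrix.of fun i j : Fin 1 => if i.val + j.val + 1 = 1 then (1 : L) else 0)).Local v))
      (νG : ∀ v : HeightOneSpectrum (𝓞 ↥(maximalRealSubfield L)), Measure ((UnitaryGroup.cmDatum L 3 H').Local v))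
      [∀ v, (νH v).IsHaarMeasure] [∀ v, (νH v).IsMulRightInvariant] [∀ v, (νG v).IsHaarMeasure] [∀ v, (νG v).IsMulRightInvariant],
      μ.IsUnitary →
      (∀ x : ideleGroup ↥(maximalRealSubfield L), μ (AdeleRing.ideleBaseChange (↥(maximalRealSubfield L)) L x) = quadraticHeckeCharCM L x) →
      (H'.map (cmConjRingHom L)).transpose = H' →
      (∀ x : Fin 3 → L, Literature.AlgebraicGeometry.ShimuraVarieties.hermForm (cmConjRingHom L) H' x x = 0 → x = 0) →
      ∀ (v : HeightOneSpectrum (𝓞 ↥(maximalRealSubfield L))), Subsingleton (UnitaryGroup.PlacesOver L v) →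
      ∀ [_iH : ∀ a : ((UnitaryGroup.cmDatum L 2 (Matrix.of fun i j : Fin 2 => if i.val + j.val + 1 = 2 then (1 : L) else 0)).Local v × (UnitaryGroup.cmDatum L 1 (Matrix.of fun i j : Fin 1 => if i.val + j.val + 1 = 1 then (1 : L) else 0)).Local v),
          MeasurableSpace (((UnitaryGroup.cmDatum L 2 (Matrix.of fun i j : Fin 2 => if i.val + j.val + 1 = 2 then (1 : L) else 0)).Local v × (UnitaryGroup.cmDatum L 1 (Matrix.of fun i j : Fin 1 => if i.val + j.val + 1 = 1 then (1 : L) else 0)).Local v) ⧸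
            Subgroup.centralizer ({a} : Set ((UnitaryGroup.cmDatum L 2 (Matrix.of fun i j : Fin 2 => if i.val + j.val + 1 = 2 then (1 : L) else 0)).Local v × (UnitaryGroup.cmDatum L 1 (Matrix.of fun i j : Fin 1 => if i.val + j.val + 1 = 1 then (1 : L) else 0)).Local v)))]
        [_bH : ∀ a : ((UnitaryGroup.cmDatum L 2 (Matrix.of fun i j : Fin 2 => if i.val + j.val + 1 = 2 then (1 : L) else 0)).Local v × (UnitaryGroup.cmDatum L 1 (Matrix.of fun i j : Fin 1 => if i.val + j.val + 1 = 1 then (1 : L) else 0)).Local v),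
          BorelSpace (((UnitaryGroup.cmDatum L 2 (Matrix.of fun i j : Fin 2 => if i.val + j.val + 1 = 2 then (1 : L) else 0)).Local v × (UnitaryGroup.cmDatum L 1 (Matrix.of fun i j : Fin 1 => if i.val + j.val + 1 = 1 then (1 : L) else 0)).Local v) ⧸
            Subgroup.centralizer ({a} : Set ((UnitaryGroup.cmDatum L 2 (Matrix.of fun i j : Fin 2 => if i.val + j.val + 1 = 2 then (1 : L) else 0)).Local v × (UnitaryGroup.cmDatum L 1 (Matrix.of fun i j : Fin 1 => if i.val + j.val + 1 = 1 then (1 : L) else 0)).Local v)))]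
        [_iG : ∀ γ : ((UnitaryGroup.cmDatum L 3 H').Local v), MeasurableSpace (((UnitaryGroup.cmDatum L 3 H').Local v) ⧸ Subgroup.centralizer ({γ} : Set ((UnitaryGroup.cmDatum L 3 H').Local v)))]
        [_bG : ∀ γ : ((UnitaryGroup.cmDatum L 3 H').Local v), BorelSpace (((UnitaryGroup.cmDatum L 3 H').Local v) ⧸ Subgroup.centralizer ({γ} : Set ((UnitaryGroup.cmDatum L 3 H').Local v)))]
        (mH : OrbitalMeasureFamily ((UnitaryGroup.cmDatum L 2 (Matrix.of fun i j : Fin 2 => if i.val + j.val + 1 = 2 then (1 : L) else 0)).Local v × (UnitaryGroup.cmDatum L 1 (Matrix.of fun i j : Fin 1 => if i.val + j.val + 1 = 1 then (1 : L) else 0)).Local v))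
        (mG : OrbitalMeasureFamily ((UnitaryGroup.cmDatum L 3 H').Local v)),
      mH.IsCanonical (IsLocalGRegular L v) (νH v) → mG.IsCanonical (fun γ => IsRegularElt (γ.val : GL (Fin 3) (UnitaryGroup.LocalRing L v))) (νG v) →
      ∀ (φ : ((UnitaryGroup.cmDatum L 3 H').Local v) → ℂ), IsLocSmooth φ →
      ∀ (εH : ((UnitaryGroup.cmDatum L 2 (Matrix.of fun i j : Fin 2 => if i.val + j.val + 1 = 2 then (1 : L) else 0)).Local v × (UnitaryGroup.cmDatum L 1 (Matrix.of fun i j : Fin 1 => if i.val + j.val + 1 = 1 then (1 : L) else 0)).Local v)) (a : (UnitaryGroup.LocalRing L v)),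
        (εH.1.val.val : Matrix (Fin 2) (Fin 2) (UnitaryGroup.LocalRing L v)) = a • (1 : Matrix (Fin 2) (Fin 2) (UnitaryGroup.LocalRing L v)) →
        (εH.2.val.val : Matrix (Fin 1) (Fin 1) (UnitaryGroup.LocalRing L v)) 0 0 ≠ a →
        -- the central dock (★ `exists_centralDock_of_fst_eq_smul_one`)
        ∀ (ε : ((UnitaryGroup.cmDatum L 3 H').Local v)) (y : GL (Fin 3) (UnitaryGroup.LocalRing L v)) (θ : ((UnitaryGroup.cmDatum L 2 (Matrix.of fun i j : Fin 2 => if i.val + j.val + 1 = 2 then (1 : L) else 0)).Local v × (UnitaryGroup.cmDatum L 1 (Matrix.of fun i j : Fin 1 => if i.val + j.val + 1 = 1 then (1 : L) else 0)).Local v) ≃ₜ* ↥(Subgroup.centralizer ({ε} : Set ((UnitaryGroup.cmDatum L 3 H').Local v)))),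
        (θ εH).1 = ε →
        (∀ z : ((UnitaryGroup.cmDatum L 2 (Matrix.of fun i j : Fin 2 => if i.val + j.val + 1 = 2 then (1 : L) else 0)).Local v × (UnitaryGroup.cmDatum L 1 (Matrix.of fun i j : Fin 1 => if i.val + j.val + 1 = 1 then (1 : L) else 0)).Local v), (((θ z).1).val : GL (Fin 3) (UnitaryGroup.LocalRing L v)) = y * ((endoEmbLocal L v z).val : GL (Fin 3) (UnitaryGroup.LocalRing L v)) * y⁻¹) →
        -- the bad frame on the dock (★ `exists_badFrame_dock`)
        ∀ (W : GL (Fin 3) (UnitaryGroup.LocalRing L v)), W.val = !![(1 : UnitaryGroup.LocalRing L v), 0, 0; 0, 0, 1; 0, 1, 0] →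
        ∀ (G₁ G₁' : Matrix (Fin 2) (Fin 2) (UnitaryGroup.LocalRing L v)) (G₂ G₂' : Matrix (Fin 1) (Fin 1) (UnitaryGroup.LocalRing L v)) (P' : GL (Fin (2 + 1)) (UnitaryGroup.LocalRing L v)),
        twistGram (UnitaryGroup.conjLocal L (IsCMField.complexConj L) v) ((UnitaryGroup.adelicForm L 3 H').map (UnitaryGroup.adeleToLocal L v)) (y * W).val = UnitaryGroup.finSum 2 1 G₁ G₂ →
        twistGram (UnitaryGroup.conjLocal L (IsCMField.complexConj L) v) ((UnitaryGroup.adelicForm L 3 H').map (UnitaryGroup.adeleToLocal L v)) P'.val = UnitaryGroup.finSum 2 1 G₁' G₂' →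
        (¬ ∃ z : UnitaryGroup.LocalRing L v, IsUnit z ∧ G₁'.det = G₁.det * (UnitaryGroup.conjLocal L (IsCMField.complexConj L) v z * z)) →
        -- the orbit of the dock point `ε` is closed (`(ε − a)(ε − u) = 0` with `a − u` a unit: ★ `isClosed_conjClass_local_of_mul_sub_smul_eq_zero`)
        IsClosed {g : ((UnitaryGroup.cmDatum L 3 H').Local v) | ∃ x : ((UnitaryGroup.cmDatum L 3 H').Local v), x * ε * x⁻¹ = g} →
        ∃ (ε' : ((UnitaryGroup.cmDatum L 3 H').Local v)) (r : ℝ),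
          (ε'.val.val : Matrix (Fin 3) (Fin 3) (UnitaryGroup.LocalRing L v)) * P'.val =
            P'.val * UnitaryGroup.finSum 2 1 (a • (1 : Matrix (Fin 2) (Fin 2) (UnitaryGroup.LocalRing L v))) (εH.2.val.val : Matrix (Fin 1) (Fin 1) (UnitaryGroup.LocalRing L v)) ∧
          IsLocalNormPair L H' v εH ε' ∧ 0 < r ∧
          ∃ V ∈ 𝓝 εH, ∃ φH : ((UnitaryGroup.cmDatum L 2 (Matrix.of fun i j : Fin 2 => if i.val + j.val + 1 = 2 then (1 : L) else 0)).Local v × (UnitaryGroup.cmDatum L 1 (Matrix.of fun i j : Fin 1 => if i.val + j.val + 1 = 1 then (1 : L) else 0)).Local v) → ℂ, IsLocSmooth φH ∧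
            (∀ γH ∈ V, IsLocalGRegular L v γH →
              stableOrbitalIntegralRel (IsLocalStablyConjH L v) mH φH γH =
                ∑ᶠ c : ConjClasses ((UnitaryGroup.cmDatum L 3 H').Local v), ((finExplicitCollection L H' μ (finExplicitDelta_conj_left_all L H' μ) (finExplicitDelta_conj_right_all L H' μ)) v).Δ γH (Quotient.out c) *
                  classOrbitalIntegral mG φ c) ∧
            ∀ (νM : Measure ↥(Subgroup.centralizer ({ε} : Set ((UnitaryGroup.cmDatum L 3 H').Local v)))) [νM.IsHaarMeasure] [νM.IsInvInvariant],
              νM = Measure.map (⇑θ) (νH v) →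
              φH εH =
                finExplicitDelta L v H' εH μ ε *
                    orbitalIntegral ε φ (quotientMeasure (Subgroup.centralizer ({ε} : Set ((UnitaryGroup.cmDatum L 3 H').Local v))) νM
                      (isClosed_coe_centralizer_singleton ε) (νG v)) +
                  finExplicitDelta L v H' εH μ ε' * (∫ y, φ (y * ε' * y⁻¹) ∂(νG v)) * (-(r : ℂ)) := by
  intro L _ _ _ H' μ _ _ _ _ νH νG _ _ _ _ hμu hμω hherm hanis v hv _iH _bH _iG _bG mH mG hmH hmG φ hφ εH a ha hu ε y θ hθε hθ W hW G₁ G₁' G₂ G₂' P'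
    hPW hP' hnn hεO
  classical
  -- (1) the compact-side package WITH VALUES (★ rung 5): `C′ = Z(ε′)`, the framed second class `ε′`, descent value, named `Δ‴` constant, count
  obtain ⟨C', iGrp, iTop, iTG, iCpt, iLC, iSC, iT2, iMeas, iBor, iQM, iQB, ν', iHaar, iRI, P'', m', hm', εC, ε', hε'P, hmatch, hcentral, hν'ne, hD', hΔ', hcnt⟩ :=
    exists_compactSidePackage_of_badFrame_withValues L H' μ νH νG hμu hμω hherm hanis v hv mH mG hmH hmG φ hφ εH a ha hu ε y θ hθε hθ
      W hW G₁ G₁' G₂ G₂' P' hPW hP' hnn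
  -- (2) the place above `v`, `det H′ ≠ 0`, the dock read as `y ι(ε_H) y⁻¹ = ε`
  obtain ⟨w⟩ := PlacesOver.nonempty L v
  have hw : IsCMField.complexConj L • w.1 = w.1 := smul_eq_of_subsingleton_placesOver L hv w
  have hdet' : H'.det ≠ 0 := by
    intro hdet
    obtain ⟨x, hx, hHx⟩ := Matrix.exists_mulVec_eq_zero_iff.mpr hdet
    exact hx (hanis x (by rw [Literature.AlgebraicGeometry.ShimuraVarieties.hermForm, hHx, dotProduct_zero]))
  have hy : y * ((endoEmbLocal L v εH).val : GL (Fin 3) (UnitaryGroup.LocalRing L v)) * y⁻¹ = ε.val := by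
    rw [← hθ εH, hθε]
  -- (3) the transported Haar measure `θ_* ν_H` on `Z(ε)`
  have hMc : IsClosed (((Subgroup.centralizer ({ε} : Set ((UnitaryGroup.cmDatum L 3 H').Local v))) : Subgroup ((UnitaryGroup.cmDatum L 3 H').Local v)) : Set ((UnitaryGroup.cmDatum L 3 H').Local v)) := isClosed_coe_centralizer_singleton ε
  haveI : LocallyCompactSpace ↥(Subgroup.centralizer ({ε} : Set ((UnitaryGroup.cmDatum L 3 H').Local v))) := hMc.isClosedEmbedding_subtypeVal.locallyCompactSpace
  haveI hM1 : (Measure.map (⇑θ) (νH v)).IsHaarMeasure := MulEquiv.isHaarMeasure_map (νH v) θ.toMulEquiv θ.continuous θ.symm.continuous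
  haveI hM2 : (Measure.map (⇑θ) (νH v)).IsMulRightInvariant :=
    isMulRightInvariant_map_mulEquiv_of_isMulRightInvariant θ.toMulEquiv θ.continuous.measurable (νH v)
  haveI hM3 : (Measure.map (⇑θ) (νH v)).IsInvInvariant :=
    isInvInvariant_of_isMulRightInvariant_of_isClosed (Subgroup.centralizer ({ε} : Set ((UnitaryGroup.cmDatum L 3 H').Local v))) hMc (Measure.map (⇑θ) (νH v))
  -- (4) the compact side WITH VALUE (★ rung 3 over ★ J2♯): the EP constant `r > 0`
  obtain ⟨r, hr, hI'⟩ := exists_nhds_finsum_side_eq_stableOrbitalIntegralRel_and_apply_centre_of_compact_dock L H' v hv μ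
    (finExplicitDelta_conj_left_all L H' μ) (finExplicitDelta_conj_right_all L H' μ) (νH v) hmH εH a ha
    (fun γH g => ∃ B : Matrix (Fin 2) (Fin 2) (UnitaryGroup.LocalRing L v),
      (g.val.val : Matrix (Fin 3) (Fin 3) (UnitaryGroup.LocalRing L v)) * P'.val = P'.val * UnitaryGroup.finSum 2 1 B (γH.2.val.val : Matrix (Fin 1) (Fin 1) (UnitaryGroup.LocalRing L v)))
    C' ν' P'' hm' εC hcentral (fun ψ => (((ν'.real Set.univ)⁻¹ : ℝ) : ℂ) * ∫ y, ψ (y * ε' * y⁻¹) ∂(νG v)) hD' (finExplicitDelta L v H' εH μ ε') hΔ' hcnt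
  -- (5) the junction WITH VALUE (★ rung 1) over the descent WITH VALUE (★ J1)
  obtain ⟨V, hV, φH, hφH, hid, hval⟩ := exists_nhds_stableOrbitalIntegralRel_eq_and_apply_centre_of_central_singular_inv L H' v hherm hdet' μ
    (finExplicitDelta_conj_left_all L H' μ) (finExplicitDelta_conj_right_all L H' μ) (νH v) hmH εH ε y θ hθ
    (fun γH g => ∃ B : Matrix (Fin 2) (Fin 2) (UnitaryGroup.LocalRing L v),
      (g.val.val : Matrix (Fin 3) (Fin 3) (UnitaryGroup.LocalRing L v)) * P'.val = P'.val * UnitaryGroup.finSum 2 1 B (γH.2.val.val : Matrix (Fin 1) (Fin 1) (UnitaryGroup.LocalRing L v)))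
    (exists_nhds_stablySaturated_sep_dock w hw εH a ha hu ε y θ hy hθ)
    ⟨univ, univ_mem, fun γH _ hreg γ' hm => side_of_dock L H' v w hw hherm hdet' εH a ha θ hθ hW hy hPW hP' hnn γH hreg γ' hm⟩
    ⟨univ, univ_mem, fun γH _ hreg γ' h₁ h₂ => disj_of_dock L H' v θ hθ hW hPW hP' hnn γH hreg γ' h₁ h₂⟩
    (fun ψ => orbitalIntegral ε ψ (quotientMeasure (Subgroup.centralizer ({ε} : Set ((UnitaryGroup.cmDatum L 3 H').Local v))) (Measure.map (⇑θ) (νH v))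
      (isClosed_coe_centralizer_singleton ε) (νG v)))
    (fun ψ => finExplicitDelta L v H' εH μ ε' * ((((ν'.real Set.univ : ℝ)) : ℂ) * ((((ν'.real Set.univ)⁻¹ : ℝ) : ℂ) * ∫ y, ψ (y * ε' * y⁻¹) ∂(νG v))) * (-(r : ℂ)))
    (fun ψ hψ => by
      obtain ⟨B, hB, hsat, ψε, hψε, hvalε, hdesc⟩ :=
        exists_nhds_classOrbitalIntegral_dock_eq_and_apply_centre L H' v hherm hdet' w hw (νH v) (νG v) hmH hmG εH a ha hu ε y θ hθε hθ hεO ψ hψ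
      exact ⟨B, hB, hsat, ψε, hψε, hdesc, hvalε _ rfl⟩)
    (exists_nhds_finExplicitDelta_dock_eq w hw μ εH a ha hu ε y θ hy hθ)
    hI' φ hφ
  -- (6) the value at the centre
  refine ⟨ε', r, hε'P, hmatch, hr, V, hV, φH, hφH, hid, ?_⟩
  have hc : (ν'.real Set.univ : ℝ) ≠ 0 := fun h => hν'ne (by rw [h, Complex.ofReal_zero])
  have hcI : (((ν'.real Set.univ : ℝ)) : ℂ) * ((((ν'.real Set.univ)⁻¹ : ℝ) : ℂ) * ∫ y, φ (y * ε' * y⁻¹) ∂(νG v)) = ∫ y, φ (y * ε' * y⁻¹) ∂(νG v) := by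
    rw [← mul_assoc, ← Complex.ofReal_mul, mul_inv_cancel₀ hc, Complex.ofReal_one, one_mul]
  intro νM _ _ hνM
  subst hνM
  rw [hval, hcI]

end Summit.HodgeConjecture.HodgeConjecture.Cruxes.H413.K2E3SingularTransferDressValueAtCentre

end
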